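import Literature.MathematicalPhysics.QuantumFieldTheory.Balaban1983to89.B9Thm34GpKernelFinal
import Literature.MathematicalPhysics.QuantumFieldTheory.Balaban1983to89.B9Thm34SectBUniform

/-!
# `Balaban1983to89.B9Thm34GpKernelUniform` — [Balaban1985BackgroundPropagators] THEOREM 3.4 p. 400, THE `G′(U′U)`-CLAUSE WITH ALL FOUR ENTRIES
# (3.42)₁₋₄ OF `G′(U′U)` IN THE PRINTED KERNEL FORM AND THE CONSTANTS CHOSEN BEFORE THE LATTICE: `∃ a₁ > 0 ∃ B ∀ (T_η, k, {Ω_j}, U, …)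
# ∀ α₁ ≦ a₁ ∀ A` — the uniformity «the constants in the formulations of both theorems do not depend on the sequence {Ω_j}» (p. 399) made a
# theorem for FILE 29's clause (FILE 49 of the Sect. B programme of cell `lit-balaban`, seat r06 gen 21; the kernel-form twin of FILE 45 §1)

statement-level skeleton of published theorems with citation tags; proofs where landed; nothing here is a claim about the Yang–Mills mass gap

CITATION HEADER (lean-in-tree rule).  B9 = T. Bałaban, *Propagators for lattice gauge theories in a background field*, Commun. Math. Phys.
**99** (1985) 389–434 [Balaban1985BackgroundPropagators] (held `paper:balaban1985-cmp99-background-propagators`; journal page = PDF page + 388):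
Theorem 3.4 p. 400 [PDF 12] L7–10 «There exists a positive constant a₁ such that the operators G′(U), (Q′(U)G′²(U)Q′*(U))⁻¹, R(U), G(U) extend
to configurations U′U for α₁ ≦ a₁ as analytic functions of A. The extended operators satisfy all the inequalities of Theorems 3.1–3.3
correspondingly»; Theorem 3.1 p. 397 [PDF 9] «There exist positive constants M₁, δ₀, a₀, B₀ dependent on d and L only» and (3.42)
«|G′(x,x′)|, |(∇_U G′)(b,x′)|, |(G′∇*_U)(x,c)|, |(∇_U G′∇*_U)(b,c)| ≦ B₀[(Lʲη)², Lʲη, Lʲη, 1](L^{j′}η)^{−d}e^{−δ₀d(y,y′)} for x ∈ Δ(y),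
x′ ∈ Δ(y′), y ∈ Λ_j, y′ ∈ Λ_{j′}» (the printed KERNEL shape = `B6RandomWalkKernel.HasKernelBound`, kernels for the pairing ⟨λ,λ′⟩ = Σ η^d tr λλ′
of p. 393, block volume weight `v(y′) = (L^{j′}η)^d`); p. 399 [PDF 11] L1–3 «Let us stress that the constants in the formulations of both
theorems do not depend on the sequence {Ω_j}, j = 0, 1, …, k, if the conditions (2.1), (2.2) are satisfied»; p. 402 [PDF 14] (3.60)–(3.65)
«We assume that Theorem 3.1 is valid for the operator G′(U) … the operator V′(A)G′(U) satisfies the bound |(V′(A)G′(U)λ)(x)| ≦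
O(1)B₀α₁e^{−δ₀d(y,y′)} (3.63) … G′(U′U) = G′(U) + G′(U)V′(A)G′(U′U) = G′(U) + G′(U′U)V′(A)G′(U), (3.65)»; p. 403 [PDF 15, L1–9] «Now applying
Theorem 3.1 for G′(U), the bound (3.63), the representation (3.64) and Lemma 2.1 of [4] we can prove all the statements (3.42)–(3.47) of
Theorem 3.1 for the operator G′(U′U), of course with different constants, although changes are small. We define new constants in such a way
that the statements of Theorem 3.1 hold for extended operators.»; p. 398 remark after (3.47) «Using Lemma 2.1 in [4] we may replace the factor
(Lʲη)^α by (Lʲη)^β(L^{j′}η)^γ with β + γ = α»; (3.19)/(3.24) pp. 393–394; (3.59) p. 402; (3.37) p. 396.  [4] = [Balaban1984PropagatorsII]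
T. Bałaban, *Propagators and renormalization transformations for lattice gauge theories. II*, Commun. Math. Phys. **96** (1984) 223–250:
Lemma 2.1 p. 234 [PDF 12] («For the numbers α, 0 < α < 1, c₁(α) = 12c₀(½α), and RM satisfying (2.59)» — no dependence on the torus, k or
{Ω_j}), (2.51)–(2.55) p. 232, (2.66) p. 234.  Rows B9.Thm3.4 × B9.Thm3.1 × B9.Eq3.62 (cells only; no row head changes).

WHY THIS FILE (B9-CLOSURE §3 item 4, §5 item 2 (M); FILE 29 HONEST SCOPE (iv) «`a₁`, `B` are packaged existentially after the lattice is fixed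
(their values depend on `d, L, δ₀, B_G` and the scale-transfer constants only)»; INTERFACES-r06 §46/§47 RECIPE).  FILES 45–48 (r06 gen 20)
re-quantified the Sect. B step's block-majorant clauses and the `G(U′U)` kernel form with `a₁`, `B` BEFORE the lattice; the kernel-form
clauses for `G′(U′U)` (FILE 29), the (3.65) remainders (FILE 32), `P(U′U)` (FILE 30), `P′(A)` (FILE 33) and the kernel-form one-name capstone
(FILE 31) kept the per-lattice shape `∀ (lattice, background, letters) ∃ a₁ ∃ B ∀ α₁ ∀ A`.  This file starts the kernel-form half of the
recipe with FILE 29: its proof already computes `a₁` and `B` from lattice-free quantities only — [4] Lemma 2.1's `c₁(d; δ₀, 1/100)` (`B6.c1`),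
the p. 398 scale-transfer constant at exponent `1/100`, `|κ|`, `M₂Σ_i‖b_i‖`, `B_G`, `C_q`, `a₀`, `δ₀`, `d₀` and FILE 26's threshold/constant —
EXCEPT that the scale-transfer constant was taken from the per-lattice hypothesis `∃ Λ ≧ 1`.  Here the p. 398 / [4] Lemma 2.1 scale transfer
is hypothesised in its printed uniform form (ONE function `Λ : (0,∞) → [1,∞)` serving every lattice of the family, as in FILES 45–48) and the
quantifiers are re-ordered.

WHAT IS PROVED (1 theorem: 0 `def`, 0 sorry, 0 new named facts; standard axioms).
* **`thm34_Gp_kernel_uniform`** — FILE 29 `thm34_Gp_kernel_final` (the `G′(U′U)`-clause in the printed kernel form: `G′(U′U) := gPrimeExtEnd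
  G′(U) (V′(A)G′(U))` is the two-sided inverse of `Δ′_a(U) − V′(A)` and `|G′(U′U)(x,x′)| ≦ B(Lʲη)²e^{−(4δ₀/5)d(y,y′)}v(y′)⁻¹`,
  `|(∇_kG′(U′U))(x,x′)|, |(G′(U′U)∇*_l)(x,x′)| ≦ BLʲη e^{−(4δ₀/5)d}v(y′)⁻¹`, `|(∇_kG′(U′U)∇*_l)(x,x′)| ≦ Be^{−(4δ₀/5)d}v(y′)⁻¹`) with the
  quantifier order `∃ a₁ > 0 ∃ B ≧ 0 ∀ S T U g blk kQ sQ cfun w (axioms, [4] Lemma 2.1, scale transfer with the GIVEN Λ(·), (3.19)/(3.24)/(3.60)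
  data, Theorem 3.1 for G′(U) = (Δ′_a(U))⁻¹ as block majorants (3.42)₁₋₃ AND as kernel bounds (3.42)₁₋₄ with the pairing weights v, c_K)
  ∀ α₁ ≦ a₁ ∀ A kF sF …` — hypotheses inside the `∀` = FILE 29's VERBATIM (named binders), less `hrepr` (moved before) and with `hST` in the
  uniform form.  `a₁ = min(a₁⁽⁴⁵⁾, ε/2, 1/4)` with `ε` the continuity threshold below which `θ₃₆₃(α₁) ≦ K` (`θ₃₆₃` read at `Λ(1/100)`,
  `c₁(δ₀, 1/100)`: a function of `|κ|`, `a₀`, `C_q`, `M₂Σ‖b_i‖`, `e^{δ₀d₀}`, `B_G` only); `B = B_G + B⁽⁴⁵⁾·K·Λ(1/100)·c₁(δ₀, 1/100)`.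
  (FILE 29's per-lattice statement follows by instantiation with `Λf := fun _ => Λ`.)

PROOF.  FILE 29's proof verbatim after the re-ordering: FILE 45 `B9Thm34SectBUniform.thm34_Gp_uniform` (instead of FILE 26 `thm34_Gp_final`)
and FILE 25's `exists_bound_of_continuousAt` for `θ₃₆₃` are invoked BEFORE the lattice is introduced (they mention no lattice datum); inside,
FILE 45's `∀`-clause is applied to the lattice data (`replace hfin := hfin T U blk …`), (3.65)₂ in resolvent form
(`B9Ineq385KernelConcrete.eq386_resolvent_of_inverses`), FILE 29 §1 `ineq363_kernel_vPrime` ((3.63) with the kernel on the right letter) for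
the right factors `G′(U)`, `G′(U)∇*_l` at the rate `49δ₀/50`, FILE 22's kernel step `B9Ineq385Kernel.gExt_kernelEntry_of_386` per entry
`(X, Y) ∈ {1, ∇_k} × {1, ∇*_l}` with the scale transfers at exponent `1/100` read from `Λ(1/100)`.

HONEST SCOPE / NOT CLAIMED.  As FILE 29: Theorem 3.1 FOR `U` is the INPUT (block majorants consumed by FILE 45, kernel bounds consumed by the
kernel step) — the file certifies the Sect. B implication «Thm 3.1 for G′(U) ⇒ (3.42) in kernel form for G′(U′U)» with the print's quantifier
order, not Theorem 3.1 itself (head B9.Thm3.1 stays `typed-existing`); the rate `4δ₀/5` and the exponent `1/100` are ONE admissible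
bookkeeping of «of course with different constants» (p. 403); (3.37) is read blockwise; the uniformity displayed is uniformity in the lattice
data `(S, T, 𝔅, blk)`, the background `U`, the operators, the letters and the kernel weights `(v, c_K)` AT FIXED input constants
`(δ₀, B_G, C_q, a₀, d₀, M₂, Λ(·))`, direction type `κ` and algebra `(𝔸, b)` — the print's «dependent on d and L only» is this composed with
Theorem 3.1's own uniformity and [4] Lemma 2.1; the Hölder/L²/global members (3.43)–(3.47) for `G′(U′U)` are elsewhere (FILES 34–44, p27)
and keep their shape; analyticity in `A` = the finite-lattice algebra of the Neumann series (3.64).  NOT summit progress.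

RELATED IN THE TREE, NOT DUPLICATED (searched 2026-08-23: `lean search 'Gp_kernel_uniform|GpKernelUniform' --decl` = ∅): FILE 29
`B9Thm34GpKernelFinal` (`thm34_Gp_kernel_final` per-lattice; §1 `ineq363_kernel_vPrime` USED BY NAME), FILE 45 `B9Thm34SectBUniform.thm34_Gp_uniform`,
FILE 25 `B9Thm34GKernelFinal.exists_bound_of_continuousAt`, FILE 22 `B9Ineq385Kernel.gExt_kernelEntry_of_386`,
`B9Ineq385KernelConcrete.eq386_resolvent_of_inverses` — all USED BY NAME; no existing module modified.
-/

noncomputable section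

namespace Literature.MathematicalPhysics.QuantumFieldTheory.Balaban1983to89.B9Thm34GpKernelUniform

open NormedSpace Complex
open Literature.MathematicalPhysics.QuantumFieldTheory.Balaban1983to89
open Literature.MathematicalPhysics.QuantumFieldTheory.Balaban1983to89.B6RandomWalk (HasMajorant hasMajorant_mono hasMajorant_zero Triangle254 Ineq261)
open Literature.MathematicalPhysics.QuantumFieldTheory.Balaban1983to89.B6RandomWalkKernel (HasKernelBound hasKernelBound_mono)
open Literature.MathematicalPhysics.QuantumFieldTheory.Balaban1983to89.B9Thm34Ext (toB6)
open Literature.MathematicalPhysics.QuantumFieldTheory.Balaban1983to89.B9Ineq347 (ScaleTransfer)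
open Literature.MathematicalPhysics.QuantumFieldTheory.Balaban1983to89.B9Eq386Neumann (vTotal)
open Literature.MathematicalPhysics.QuantumFieldTheory.Balaban1983to89.B9Ineq385VG (kappa385 kappa385_nonneg)
open Literature.MathematicalPhysics.QuantumFieldTheory.Balaban1983to89.B9Eq39Adjoint (covD covDstar)
open Literature.MathematicalPhysics.QuantumFieldTheory.Balaban1983to89.B9Eq352DivForm (tauB)
open Literature.MathematicalPhysics.QuantumFieldTheory.Balaban1983to89.B9Eq352DivFormLetters (conj)
open Literature.MathematicalPhysics.QuantumFieldTheory.Balaban1983to89.B9Eq352GradLetters (V0op coefLetter diffLetter hasMajorant_coefLetter)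
open Literature.MathematicalPhysics.QuantumFieldTheory.Balaban1983to89.B9Eq360Vprime (gPrimeExtEnd)
open Literature.MathematicalPhysics.QuantumFieldTheory.Balaban1983to89.B9Eq360VprimeLetters (avgOp vPrimeConc conj_vPrimeConc_eq_gradForm
  hasMajorant_V0_vPrime cBConc)
open Literature.MathematicalPhysics.QuantumFieldTheory.Balaban1983to89.B9Ineq363Vprime (cVConc cVConc_nonneg theta363 theta363_nonneg)
open Literature.MathematicalPhysics.QuantumFieldTheory.Balaban1983to89.B9Ineq385Kernel (hasKernelBound_rate_mono gExt_kernelEntry_of_386)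
open Literature.MathematicalPhysics.QuantumFieldTheory.Balaban1983to89.B9Ineq385KernelConcrete (eq386_resolvent_of_inverses ineq385_kernel_sum)
open Literature.MathematicalPhysics.QuantumFieldTheory.Balaban1983to89.B9Thm34GKernelFinal (exists_bound_of_continuousAt)
open Literature.MathematicalPhysics.QuantumFieldTheory.Balaban1983to89.B9Thm34GpKernelFinal (ineq363_kernel_vPrime)
open Literature.MathematicalPhysics.QuantumFieldTheory.Balaban1983to89.B9Thm34SectBUniform (thm34_Gp_uniform)

/-! ## Theorem 3.4, the `G′(U′U)`-clause in the printed kernel form with `a₁`, `B` chosen before the lattice -/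

section FinalU

variable {𝔸 : Type*} [NormedRing 𝔸] [NormedAlgebra ℂ 𝔸] [CompleteSpace 𝔸] {ι : Type} [Fintype ι]
variable (b : Module.Basis ι ℝ 𝔸) (κ : Type) [Fintype κ]

set_option maxHeartbeats 1600000 in
/-- **THEOREM 3.4, `G′(U′U)`-CLAUSE IN THE PRINTED KERNEL FORM, CONSTANTS BEFORE THE LATTICE** («There exists a positive constant a₁ …»,
p. 400; «the constants … do not depend on the sequence {Ω_j}», p. 399; «Now applying Theorem 3.1 for G′(U), the bound (3.63), the representation
(3.64) and Lemma 2.1 of [4] we can prove all the statements (3.42)–(3.47) of Theorem 3.1 for the operator G′(U′U), of course with different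
constants», p. 403): for fixed `d`, direction type `κ`, algebra `(𝔸, b)` with real-coordinate constant `M₂`, input constants `δ₀, B_G, C_q, a₀,
d₀` and ONE scale-transfer function `Λ(·) ≧ 1` (p. 398 / [4] Lemma 2.1), THERE EXIST `a₁ > 0` and `B ≧ 0` such that FOR EVERY lattice `(S, T)`,
multiscale geometry `𝔅 = g` with block map `blk` (axioms, [4] (2.61) at `δ₀` for every exponent, the scale transfer with `Λ(α)` for every
exponent), background `U` (unitary type, stencil range `d₀`), (3.19)/(3.24)/(3.60) data, `G′(U) = (Δ′_a(U))⁻¹` obeying Theorem 3.1 (3.42)₁₋₃ as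
block majorants at `(B_G, δ₀)` and (3.42)₁₋₄ as KERNEL bounds for the pairing weights `(v, c_K)`: for all `0 ≦ α₁ ≦ a₁`, all `A` in (3.37)
(blockwise) and (3.59) kernels, `G′(U′U) = gPrimeExtEnd G′(U) (V′(A)G′(U))` is the two-sided inverse of `Δ′_a(U) − V′(A)` and
`|G′(U′U)(x,x′)| ≦ B(Lʲη)²e^{−(4δ₀/5)d(y,y′)}v(y′)⁻¹`, `|(∇_kG′(U′U))(x,x′)|, |(G′(U′U)∇*_l)(x,x′)| ≦ BLʲη e^{−(4δ₀/5)d}v(y′)⁻¹`,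
`|(∇_kG′(U′U)∇*_l)(x,x′)| ≦ Be^{−(4δ₀/5)d}v(y′)⁻¹` — FILE 29 `thm34_Gp_kernel_final` verbatim, re-quantified.  (`a₁`, `B` = FILE 29's values
read at `Λ(1/100)` with FILE 45's threshold/constant.)
[cite: Balaban1985BackgroundPropagators, Thm 3.4 p.400 + p.399 + Thm 3.1 (3.42) p.397 + (3.60)–(3.65) p.402 + p.403 + p.398 remark + (3.19) p.393 + (3.24) p.394 + (3.59) p.402 + (3.37) p.396; Balaban1984PropagatorsII, Lemma 2.1 p.234 + (2.51)–(2.55) p.232 + (2.66) p.234] -/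
theorem thm34_Gp_kernel_uniform [DecidableEq ι] (d : ℕ)
    (δ₀ BG Cq a₀ d₀ M₂ : ℝ) (Λf : ℝ → ℝ)
    (hBG : 0 < BG) (hCq : 0 ≤ Cq) (ha₀ : 0 ≤ a₀) (hM₂ : 0 ≤ M₂) (hδ₀ : 0 < δ₀) (hΛf : ∀ α : ℝ, 0 < α → 1 ≤ Λf α)
    (hrepr : ∀ (v : 𝔸) (i : ι), |b.repr v i| ≤ M₂ * ‖v‖) :
    ∃ a₁ : ℝ, 0 < a₁ ∧ ∃ B : ℝ, 0 ≤ B ∧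
    ∀ {S : Type} [Fintype S] [DecidableEq S] (T : κ → Equiv.Perm S) (U : κ → S → 𝔸ˣ)
      {g : B9.Geometry} [Fintype g.Site] [DecidableEq g.Site] [Nonempty g.Site] {Rr : ℝ} {H : Prop} (blk : S → g.Site)
      (kQ : g.Site → S → 𝔸 →L[ℝ] 𝔸) (sQ : S → 𝔸 →L[ℝ] 𝔸) (cfun w : g.Site → ℝ)
    -- the multiscale geometry 𝔅 (p. 393, [4] (2.1)–(2.4)) and its axioms
    (hdnn : ∀ a a' : g.Site, 0 ≤ g.dist a a') (htri : Triangle254 (toB6 g Rr H)) (hrefl : ∀ y : g.Site, g.dist y y = 0)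
    (hsym : ∀ y y' : g.Site, g.dist y y' = g.dist y' y) (hlen : ∀ y : g.Site, 0 < g.len y) (hlenη : ∀ y : g.Site, g.eta ≤ g.len y)
    (hη : 0 < g.eta)
    -- [4] Lemma 2.1 (2.61) at the rate `δ₀`, «for every 0 < α < 1», and the p. 398 scale transfer for every exponent
    (h261 : ∀ α : ℝ, 0 < α → α < 1 → Ineq261 d (toB6 g Rr H) δ₀ α)
      (hST : ∀ α : ℝ, 0 < α → ScaleTransfer g δ₀ α (Λf α) (fun a => g.len a) ∧ ScaleTransfer g δ₀ α (Λf α) (fun a => g.len a ^ 2) ∧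
        ScaleTransfer g δ₀ α (Λf α) (fun a => (g.len a)⁻¹) ∧ ScaleTransfer g δ₀ α (Λf α) (fun a => (g.len a ^ 2)⁻¹) ∧
        ScaleTransfer g δ₀ α (Λf α) (fun a => (g.len a ^ 4)⁻¹) ∧ ScaleTransfer g δ₀ α (Λf α) (fun y => g.len y ^ (-(4 : ℝ))))
    (hU1 : ∀ m z, ‖((U m z : 𝔸ˣ) : 𝔸)‖ ≤ 1 ∧ ‖(((U m z)⁻¹ : 𝔸ˣ) : 𝔸)‖ ≤ 1)
    (hd₀B : ∀ μ x, g.dist (blk x) (blk ((T μ).symm x)) ≤ d₀) (hd₀F : ∀ μ x, g.dist (blk x) (blk (T μ x)) ≤ d₀)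
    (hd₀0 : ∀ y : g.Site, g.dist y y ≤ d₀)
    -- the `A`-independent data of the concrete `V′(A)` of (3.60)
    (hw : ∀ y, 0 ≤ w y) (hcard : ∀ y, ((B9Eq360Vprime.block blk y).card : ℝ) * w y ≤ 1)
    (hkQ : ∀ y x, blk x = y → ‖kQ y x‖ ≤ w y) (hsQ : ∀ x, ‖sQ x‖ ≤ 1) (hcfun : ∀ y, |cfun y| ≤ a₀ * (g.len y ^ 2)⁻¹)
    -- THEOREM 3.1 for `G′(U)`: (3.24) `G′(U) = (Δ′_a(U))⁻¹` for the letter `Δ′_a(U)`, and (3.42)₁,₂,₃ at the rate `δ₀`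
    {Δp Gp : Module.End ℝ (S × ι → ℝ)} (hΔpGp : Δp * Gp = 1) (hGpΔp : Gp * Δp = 1)
    (h342_1 : HasMajorant (g := toB6 g Rr H) (fun p : S × ι => blk p.1) Gp
      (fun a a' => BG * g.len a ^ 2 * Real.exp (-(δ₀ * g.dist a a'))))
    (h342_2 : ∀ k : κ ⊕ κ, HasMajorant (g := toB6 g Rr H) (fun p : S × ι => blk p.1)
      (conj b (diffLetter T U ((g.eta : ℂ)⁻¹) k) * Gp) (fun a a' => BG * g.len a * Real.exp (-(δ₀ * g.dist a a'))))
    (h342_3 : ∀ k : κ ⊕ κ, HasMajorant (g := toB6 g Rr H) (fun p : S × ι => blk p.1)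
      (Gp * conj b (diffLetter T U ((g.eta : ℂ)⁻¹) k)) (fun a a' => BG * g.len a * Real.exp (-(δ₀ * g.dist a a'))))
    -- the kernel pairing of p. 393 (`c = η^d`, block volume weight `v(y′) = (L^{j′}η)^d`) and THEOREM 3.1's (3.42)₁₋₄ FOR `G′(U)` IN THE PRINTED KERNEL FORM
    {v : g.Site → ℝ} (hv : ∀ y, 0 < v y) {cK : ℝ} (hcK : 0 < cK)
    (hGpk : HasKernelBound (g := toB6 g Rr H) (fun p : S × ι => blk p.1) v cK Gp
      (fun a a' => BG * g.len a ^ 2 * Real.exp (-(δ₀ * g.dist a a'))))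
    (hDGpk : ∀ k : κ ⊕ κ, HasKernelBound (g := toB6 g Rr H) (fun p : S × ι => blk p.1) v cK
      (conj b (diffLetter T U ((g.eta : ℂ)⁻¹) k) * Gp) (fun a a' => BG * g.len a * Real.exp (-(δ₀ * g.dist a a'))))
    (hGpDk : ∀ l : κ ⊕ κ, HasKernelBound (g := toB6 g Rr H) (fun p : S × ι => blk p.1) v cK
      (Gp * conj b (diffLetter T U ((g.eta : ℂ)⁻¹) l)) (fun a a' => BG * g.len a * Real.exp (-(δ₀ * g.dist a a'))))
    (hDGpDk : ∀ k l : κ ⊕ κ, HasKernelBound (g := toB6 g Rr H) (fun p : S × ι => blk p.1) v cK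
      (conj b (diffLetter T U ((g.eta : ℂ)⁻¹) k) * Gp * conj b (diffLetter T U ((g.eta : ℂ)⁻¹) l)) (fun a a' => BG * Real.exp (-(δ₀ * g.dist a a')))),
    ∀ (α₁ : ℝ), 0 ≤ α₁ → α₁ ≤ a₁ →
    -- the exponent field `A` in the domain (3.37), read blockwise, and the `A`-dependent (3.59) data `kF`, `sF`
    ∀ (A : κ → S → 𝔸) (kF : g.Site → S → 𝔸 →L[ℝ] 𝔸) (sF : S → 𝔸 →L[ℝ] 𝔸),
      (∀ y x, blk x = y → ‖kF y x‖ ≤ Cq * α₁ * w y) → (∀ x, ‖sF x‖ ≤ Cq * α₁) →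
      (∀ ν k x, ‖((g.eta : ℂ)⁻¹) • covDstar T U ν (A k) x‖ ≤ α₁ * (g.len (blk x) ^ 2)⁻¹) →
      (∀ μ ν x, ‖((g.eta : ℂ)⁻¹) • covD T U μ (A ν) x‖ ≤ α₁ * (g.len (blk x) ^ 2)⁻¹) →
      (∀ μ x, ‖((g.eta : ℂ)⁻¹) • covDstar T U μ (tauB T U μ (A μ)) x‖ ≤ α₁ * (g.len (blk x) ^ 2)⁻¹) →
      (∀ k x, ‖A k x‖ ≤ α₁ * (g.len (blk x))⁻¹) → (∀ ν k x, ‖tauB T U ν (A k) x‖ ≤ α₁ * (g.len (blk x))⁻¹) →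
      (Δp - conj b (vPrimeConc T U g.eta A blk kQ kF sQ sF cfun)) * (gPrimeExtEnd Gp (conj b (vPrimeConc T U g.eta A blk kQ kF sQ sF cfun) * Gp)) = 1 ∧
      (gPrimeExtEnd Gp (conj b (vPrimeConc T U g.eta A blk kQ kF sQ sF cfun) * Gp)) * (Δp - conj b (vPrimeConc T U g.eta A blk kQ kF sQ sF cfun)) = 1 ∧
      HasKernelBound (g := toB6 g Rr H) (fun p : S × ι => blk p.1) v cK (gPrimeExtEnd Gp (conj b (vPrimeConc T U g.eta A blk kQ kF sQ sF cfun) * Gp))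
        (fun a a' => B * g.len a ^ 2 * Real.exp (-(4 / 5 * δ₀ * g.dist a a'))) ∧
      (∀ k : κ ⊕ κ, HasKernelBound (g := toB6 g Rr H) (fun p : S × ι => blk p.1) v cK (conj b (diffLetter T U ((g.eta : ℂ)⁻¹) k) * (gPrimeExtEnd Gp (conj b (vPrimeConc T U g.eta A blk kQ kF sQ sF cfun) * Gp)))
        (fun a a' => B * g.len a * Real.exp (-(4 / 5 * δ₀ * g.dist a a')))) ∧
      (∀ l : κ ⊕ κ, HasKernelBound (g := toB6 g Rr H) (fun p : S × ι => blk p.1) v cK ((gPrimeExtEnd Gp (conj b (vPrimeConc T U g.eta A blk kQ kF sQ sF cfun) * Gp)) * conj b (diffLetter T U ((g.eta : ℂ)⁻¹) l))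
        (fun a a' => B * g.len a * Real.exp (-(4 / 5 * δ₀ * g.dist a a')))) ∧
      (∀ k l : κ ⊕ κ, HasKernelBound (g := toB6 g Rr H) (fun p : S × ι => blk p.1) v cK (conj b (diffLetter T U ((g.eta : ℂ)⁻¹) k) * (gPrimeExtEnd Gp (conj b (vPrimeConc T U g.eta A blk kQ kF sQ sF cfun) * Gp)) * conj b (diffLetter T U ((g.eta : ℂ)⁻¹) l))
        (fun a a' => B * Real.exp (-(4 / 5 * δ₀ * g.dist a a')))) := by
  classical
  -- the scale-transfer constant of the chain, READ FROM THE GIVEN FUNCTION `Λf` (lattice-free), and [4] Lemma 2.1's `c₁ ≧ 0`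
  have hΛ1 : 1 ≤ Λf (1 / 100) := hΛf _ (by norm_num)
  have hΛ0 : 0 ≤ Λf (1 / 100) := zero_le_one.trans hΛ1
  have hc1 : 0 ≤ B6.c1 d δ₀ (1 / 100) := B6RandomWalk.c1_nonneg d δ₀ (1 / 100)
  -- FILE 45: thresholds, the constant `B`, the two inverse identities and the universal left block-majorant clause for `G′(U′U)` — BEFORE THE LATTICE
  obtain ⟨a₁, ha₁, B, hB, hfin⟩ := thm34_Gp_uniform b κ d δ₀ BG Cq a₀ d₀ M₂ Λf hBG hCq ha₀ hM₂ hδ₀ hΛf hrepr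
  -- «of course with different constants» (p. 403): `θ₃₆₃(α₁)` is continuous in `α₁`, hence `≦ K` below a threshold `ε` — NO lattice datum enters
  obtain ⟨K, ε, hK, hε, hKb⟩ := exists_bound_of_continuousAt
    (f := fun α₁ : ℝ => theta363 (Fintype.card κ) 1 α₁ a₀ Cq M₂ (∑ i, ‖b i‖) (Real.exp (δ₀ * d₀)) BG (Λf (1 / 100)) (B6.c1 d δ₀ (1 / 100)))
    (by unfold theta363 kappa385 cVConc cBConc; fun_prop)
  have hB' : 0 ≤ BG + B * K * (Λf (1 / 100)) * B6.c1 d δ₀ (1 / 100) :=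
    add_nonneg hBG.le (mul_nonneg (mul_nonneg (mul_nonneg hB hK) hΛ0) hc1)
  refine ⟨min a₁ (min (ε / 2) (1 / 4)), lt_min ha₁ (lt_min (half_pos hε) (by norm_num)), BG + B * K * (Λf (1 / 100)) * B6.c1 d δ₀ (1 / 100), hB', ?_⟩
  -- NOW the lattice, the background, the (3.19)/(3.24)/(3.60) data, Theorem 3.1 for `U` (block and kernel members); then `α₁`, `A`
  intro S _ _ T U g _ _ _ Rr H blk kQ sQ cfun w hdnn htri hrefl hsym hlen hlenη hη h261 hST hU1 hd₀B hd₀F hd₀0 hw hcard hkQ hsQ hcfun Δp Gp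
    hΔpGp hGpΔp h342_1 h342_2 h342_3 v hv cK hcK hGpk hDGpk hGpDk hDGpDk α₁ hα₁0 hα₁1 A kF sF hkF hsF h337B h337F h337Bτ hA hAτB
  replace hfin := hfin T U blk kQ sQ cfun w hdnn htri hrefl hsym hlen hlenη hη h261 hST hU1 hd₀B hd₀F hd₀0 hw hcard hkQ hsQ hcfun hΔpGp
    hGpΔp h342_1 h342_2 h342_3
  -- the p. 398 scale transfers and [4] Lemma 2.1 at exponent `1/100`
  obtain ⟨hT1, hT2, hT1i, -, -, -⟩ := hST (1 / 100) (by norm_num)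
  have h261β : Ineq261 d (toB6 g Rr H) δ₀ (1 / 100) := h261 _ (by norm_num) (by norm_num)
  have hα₁a : α₁ ≤ a₁ := hα₁1.trans (min_le_left _ _)
  have hα₁ε : α₁ ≤ ε / 2 := hα₁1.trans ((min_le_right _ _).trans (min_le_left _ _))
  have hα₁q : α₁ ≤ 1 / 4 := hα₁1.trans ((min_le_right _ _).trans (min_le_right _ _))
  obtain ⟨i1, i2, hL, -⟩ := hfin α₁ hα₁0 hα₁a A kF sF hkF hsF h337B h337F h337Bτ hA hAτB
  have hθK : theta363 (Fintype.card κ) 1 α₁ a₀ Cq M₂ (∑ i, ‖b i‖) (Real.exp (δ₀ * d₀)) BG (Λf (1 / 100)) (B6.c1 d δ₀ (1 / 100)) ≤ K :=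
    hKb α₁ (by rw [abs_of_nonneg hα₁0]; linarith)
  -- (3.65)₂ in resolvent form, from the two inverse identities: `G′(U′U) = G′(U) + G′(U′U)·(V′(A)G′(U))`
  have h365 : gPrimeExtEnd Gp (conj b (vPrimeConc T U g.eta A blk kQ kF sQ sF cfun) * Gp) = Gp + (gPrimeExtEnd Gp (conj b (vPrimeConc T U g.eta A blk kQ kF sQ sF cfun) * Gp)) * (conj b (vPrimeConc T U g.eta A blk kQ kF sQ sF cfun) * Gp) :=
    eq386_resolvent_of_inverses (Δ := Δp) (Δ' := Δp - conj b (vPrimeConc T U g.eta A blk kQ kF sQ sF cfun)) (V := conj b (vPrimeConc T U g.eta A blk kQ kF sQ sF cfun)) hΔpGp i2 rfl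
  -- the shapes in which §1 reads (3.37), the transports and the stencil geometry
  have hsmall : ∀ y : g.Site, g.eta * (α₁ * (g.len y)⁻¹) ≤ 1 / 4 := fun y => by
    have hq : g.eta * (g.len y)⁻¹ ≤ 1 := by
      rw [← div_eq_mul_inv]; exact (div_le_one (hlen y)).mpr (hlenη y)
    calc g.eta * (α₁ * (g.len y)⁻¹) = α₁ * (g.eta * (g.len y)⁻¹) := by ring
      _ ≤ α₁ * 1 := mul_le_mul_of_nonneg_left hq hα₁0
      _ ≤ 1 / 4 := by linarith
  have hA' : ∀ μ x, ‖A μ x‖ ≤ α₁ * (g.len (blk x))⁻¹ ∧ ‖tauB T U μ (A μ) x‖ ≤ α₁ * (g.len (blk x))⁻¹ :=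
    fun μ x => ⟨hA μ x, hAτB μ μ x⟩
  have h337s' : ∀ μ x, ‖((g.eta : ℂ)⁻¹) • covDstar T U μ (A μ) x‖ ≤ α₁ * (g.len (blk x) ^ 2)⁻¹ := fun μ x => h337B μ μ x
  have hd₀' : ∀ μ x, g.dist (blk x) (blk (T μ x)) ≤ d₀ ∧ g.dist (blk x) (blk ((T μ).symm x)) ≤ d₀ :=
    fun μ x => ⟨hd₀F μ x, hd₀B μ x⟩
  -- elementary identities for the weights `(Lʲη)², Lʲη, 1, (Lʲη)⁻¹`
  have hl21 : ∀ a : g.Site, g.len a ^ 2 * (g.len a)⁻¹ = g.len a := fun a => by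
    rw [pow_two, mul_assoc, mul_inv_cancel₀ (hlen a).ne', mul_one]
  have hl10 : ∀ a : g.Site, g.len a * (g.len a)⁻¹ = 1 := fun a => mul_inv_cancel₀ (hlen a).ne'
  have hl22 : ∀ a : g.Site, (g.len a ^ 2)⁻¹ * g.len a ^ 2 = 1 := fun a => inv_mul_cancel₀ (pow_ne_zero 2 (hlen a).ne')
  have hl2i1 : ∀ a : g.Site, (g.len a ^ 2)⁻¹ * g.len a = (g.len a)⁻¹ := fun a => by
    rw [pow_two, mul_inv, mul_assoc, inv_mul_cancel₀ (hlen a).ne', mul_one]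
  -- scale transfers for the weights `(Lʲη)²·(Lʲη)⁻¹ = Lʲη`, `Lʲη·(Lʲη)⁻¹ = 1` and `1`
  have hSTone : ScaleTransfer g δ₀ (1 / 100) (Λf (1 / 100)) (fun _ : g.Site => (1 : ℝ)) := fun y y' => by
    simp only [mul_one]
    have h0 : 0 ≤ 1 / 100 * δ₀ * g.dist y y' := mul_nonneg (mul_nonneg (by norm_num) hδ₀.le) (hdnn y y')
    exact (Real.exp_le_one_iff.mpr (by linarith)).trans hΛ1
  have hw21 : (fun a : g.Site => g.len a ^ 2 * (g.len a)⁻¹) = fun a => g.len a := funext hl21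
  have hw10 : (fun a : g.Site => g.len a * (g.len a)⁻¹) = fun _ => (1 : ℝ) := funext hl10
  have hT21 : ScaleTransfer g δ₀ (1 / 100) (Λf (1 / 100)) (fun a : g.Site => g.len a ^ 2 * (g.len a)⁻¹) := by rw [hw21]; exact hT1
  have hT10 : ScaleTransfer g δ₀ (1 / 100) (Λf (1 / 100)) (fun a : g.Site => g.len a * (g.len a)⁻¹) := by rw [hw10]; exact hSTone
  have hρ1 : 49 / 50 * δ₀ + (1 / 100 + 1 / 100) * δ₀ ≤ δ₀ := by linarith
  have hρ10 : 0 ≤ 49 / 50 * δ₀ := by linarith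
  -- Theorem 3.1's kernel entries of `G′(U)` in the weight shapes §1 reads
  have hDGpk' : ∀ k : κ ⊕ κ, HasKernelBound (g := toB6 g Rr H) (fun p : S × ι => blk p.1) v cK (conj b (diffLetter T U ((g.eta : ℂ)⁻¹) k) * Gp)
      (fun a a' => BG * (g.len a ^ 2 * (g.len a)⁻¹) * Real.exp (-(δ₀ * g.dist a a'))) := fun k =>
    hasKernelBound_mono (g := toB6 g Rr H) _ hv (hDGpk k) fun a a' => le_of_eq (by rw [hl21])
  have hDGpDk' : ∀ k l : κ ⊕ κ, HasKernelBound (g := toB6 g Rr H) (fun p : S × ι => blk p.1) v cK (conj b (diffLetter T U ((g.eta : ℂ)⁻¹) k) * Gp * conj b (diffLetter T U ((g.eta : ℂ)⁻¹) l))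
      (fun a a' => BG * (g.len a * (g.len a)⁻¹) * Real.exp (-(δ₀ * g.dist a a'))) := fun k l =>
    hasKernelBound_mono (g := toB6 g Rr H) _ hv (hDGpDk k l) fun a a' => le_of_eq (by rw [hl10, mul_one])
  -- §1: (3.63) with the kernel on the right letter, right factors `G′(U)` (`w = (Lʲη)²`) and `G′(U)∇*_l` (`w = Lʲη`), at the rate `49δ₀/50`
  have k1 : HasKernelBound (g := toB6 g Rr H) (fun p : S × ι => blk p.1) v cK (conj b (vPrimeConc T U g.eta A blk kQ kF sQ sF cfun) * Gp)
      (fun a a' => theta363 (Fintype.card κ) 1 α₁ a₀ Cq M₂ (∑ i, ‖b i‖) (Real.exp (δ₀ * d₀)) BG (Λf (1 / 100)) (B6.c1 d δ₀ (1 / 100)) * ((g.len a ^ 2)⁻¹ * g.len a ^ 2) * Real.exp (-(49 / 50 * δ₀ * g.dist a a'))) :=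
    ineq363_kernel_vPrime (Rr := Rr) (H := H) b T U blk d hη A kQ kF sQ sF cfun w 1 d₀ M₂ Cq a₀ δ₀ δ₀ (1 / 100) (1 / 100)
      (49 / 50 * δ₀) (Λf (1 / 100)) BG α₁ (fun a => g.len a ^ 2) hBG.le hα₁0 hΛ0 hρ10 (by norm_num) (by norm_num) hδ₀.le hδ₀.le hρ1 hdnn htri hlen h261β
      (fun a => sq_nonneg _) hT2 hT21 hM₂ hrepr hsmall hA' h337s' hU1 hd₀' hd₀0 hw hcard hCq ha₀ hkQ hkF hsQ hsF hcfun hv hcK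
      (Tr := Gp) hGpk hDGpk'
  have k3 : ∀ l : κ ⊕ κ, HasKernelBound (g := toB6 g Rr H) (fun p : S × ι => blk p.1) v cK (conj b (vPrimeConc T U g.eta A blk kQ kF sQ sF cfun) * (Gp * conj b (diffLetter T U ((g.eta : ℂ)⁻¹) l)))
      (fun a a' => theta363 (Fintype.card κ) 1 α₁ a₀ Cq M₂ (∑ i, ‖b i‖) (Real.exp (δ₀ * d₀)) BG (Λf (1 / 100)) (B6.c1 d δ₀ (1 / 100)) * ((g.len a ^ 2)⁻¹ * g.len a) * Real.exp (-(49 / 50 * δ₀ * g.dist a a'))) := fun l =>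
    ineq363_kernel_vPrime (Rr := Rr) (H := H) b T U blk d hη A kQ kF sQ sF cfun w 1 d₀ M₂ Cq a₀ δ₀ δ₀ (1 / 100) (1 / 100)
      (49 / 50 * δ₀) (Λf (1 / 100)) BG α₁ (fun a => g.len a) hBG.le hα₁0 hΛ0 hρ10 (by norm_num) (by norm_num) hδ₀.le hδ₀.le hρ1 hdnn htri hlen h261β
      (fun a => (hlen a).le) hT1 hT10 hM₂ hrepr hsmall hA' h337s' hU1 hd₀' hd₀0 hw hcard hCq ha₀ hkQ hkF hsQ hsF hcfun hv hcK
      (Tr := Gp * conj b (diffLetter T U ((g.eta : ℂ)⁻¹) l)) (hGpDk l) (fun k => by simpa only [mul_assoc] using hDGpDk' k l)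
  -- … weakened to the constant `K` and the rate `4δ₀/5`
  have hexp : ∀ a a' : g.Site, Real.exp (-(49 / 50 * δ₀ * g.dist a a')) ≤ Real.exp (-(4 / 5 * δ₀ * g.dist a a')) := fun a a' => by
    have h0 : 0 ≤ δ₀ * g.dist a a' := mul_nonneg hδ₀.le (hdnn a a')
    exact Real.exp_le_exp.mpr (by linarith)
  have e1 : conj b (vPrimeConc T U g.eta A blk kQ kF sQ sF cfun) * Gp * (1 : Module.End ℝ (S × ι → ℝ)) = conj b (vPrimeConc T U g.eta A blk kQ kF sQ sF cfun) * Gp := mul_one _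
  have k1' : HasKernelBound (g := toB6 g Rr H) (fun p : S × ι => blk p.1) v cK (conj b (vPrimeConc T U g.eta A blk kQ kF sQ sF cfun) * Gp * 1)
      (fun a a' => K * (1 : ℝ) * Real.exp (-(4 / 5 * δ₀ * g.dist a a'))) := by
    rw [e1]
    refine hasKernelBound_mono (g := toB6 g Rr H) _ hv k1 fun a a' => ?_
    rw [hl22, mul_one, mul_one]
    exact mul_le_mul hθK (hexp a a') (Real.exp_pos _).le hK
  have e3 : ∀ l : κ ⊕ κ, conj b (vPrimeConc T U g.eta A blk kQ kF sQ sF cfun) * Gp * conj b (diffLetter T U ((g.eta : ℂ)⁻¹) l) = conj b (vPrimeConc T U g.eta A blk kQ kF sQ sF cfun) * (Gp * conj b (diffLetter T U ((g.eta : ℂ)⁻¹) l)) := fun l => mul_assoc _ _ _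
  have k3' : ∀ l : κ ⊕ κ, HasKernelBound (g := toB6 g Rr H) (fun p : S × ι => blk p.1) v cK (conj b (vPrimeConc T U g.eta A blk kQ kF sQ sF cfun) * Gp * conj b (diffLetter T U ((g.eta : ℂ)⁻¹) l))
      (fun a a' => K * (g.len a)⁻¹ * Real.exp (-(4 / 5 * δ₀ * g.dist a a'))) := fun l => by
    rw [e3 l]
    refine hasKernelBound_mono (g := toB6 g Rr H) _ hv (k3 l) fun a a' => ?_
    rw [hl2i1]
    exact mul_le_mul (mul_le_mul_of_nonneg_right hθK (inv_nonneg.mpr (hlen a).le)) (hexp a a') (Real.exp_pos _).le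
      (mul_nonneg hK (inv_nonneg.mpr (hlen a).le))
  -- rate bookkeeping of the kernel step: `r = δ₀`, `r′ = 9δ₀/10` (FILE 26), `ρ = 4δ₀/5`, `α = β = 1/100`
  have hr' : 4 / 5 * δ₀ + (1 / 100 + 1 / 100) * δ₀ ≤ 9 / 10 * δ₀ := by linarith
  have hrρ : 4 / 5 * δ₀ ≤ δ₀ := by linarith
  have hρ0 : 0 ≤ 4 / 5 * δ₀ := by linarith
  refine ⟨i1, i2, ?_, fun k => ?_, fun l => ?_, fun k l => ?_⟩
  · -- (3.42)₁: `(X, Y) = (1, 1)`, `P = (Lʲη)²`, `Q = 1`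
    have h342 : HasKernelBound (g := toB6 g Rr H) (fun p : S × ι => blk p.1) v cK (1 * Gp * 1)
        (fun a a' => BG * (g.len a ^ 2 * (1 : ℝ)) * Real.exp (-(δ₀ * g.dist a a'))) := by
      simpa only [one_mul, mul_one] using hGpk
    have hX : HasMajorant (g := toB6 g Rr H) (fun p : S × ι => blk p.1) (1 * gPrimeExtEnd Gp (conj b (vPrimeConc T U g.eta A blk kQ kF sQ sF cfun) * Gp))
        (fun a a' => B * g.len a ^ 2 * Real.exp (-(9 / 10 * δ₀ * g.dist a a'))) :=
      hL 1 (fun a => g.len a ^ 2) (fun a => sq_nonneg _) (by simpa only [one_mul] using h342_1)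
    have h := gExt_kernelEntry_of_386 (R := Rr) (H := H) (fun p : S × ι => blk p.1) d δ₀ (1 / 100) (1 / 100) (4 / 5 * δ₀) δ₀
      (9 / 10 * δ₀) (Λf (1 / 100)) BG B K (fun a => g.len a ^ 2) (fun _ => (1 : ℝ)) hBG.le hB hK (fun a => sq_nonneg _) (fun _ => zero_le_one)
      hΛ0 hρ0 hr' hrρ hdnn htri hSTone h261β hv hcK h365 h342 hX k1'
    simpa only [one_mul, mul_one] using h
  · -- (3.42)₂: `(X, Y) = (∇_k, 1)`, `P = Lʲη`, `Q = 1`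
    have h342 : HasKernelBound (g := toB6 g Rr H) (fun p : S × ι => blk p.1) v cK (conj b (diffLetter T U ((g.eta : ℂ)⁻¹) k) * Gp * 1)
        (fun a a' => BG * (g.len a * (1 : ℝ)) * Real.exp (-(δ₀ * g.dist a a'))) := by
      simpa only [mul_one] using hDGpk k
    have hX : HasMajorant (g := toB6 g Rr H) (fun p : S × ι => blk p.1) (conj b (diffLetter T U ((g.eta : ℂ)⁻¹) k) * gPrimeExtEnd Gp (conj b (vPrimeConc T U g.eta A blk kQ kF sQ sF cfun) * Gp))
        (fun a a' => B * g.len a * Real.exp (-(9 / 10 * δ₀ * g.dist a a'))) :=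
      hL _ (fun a => g.len a) (fun a => (hlen a).le) (h342_2 k)
    have h := gExt_kernelEntry_of_386 (R := Rr) (H := H) (fun p : S × ι => blk p.1) d δ₀ (1 / 100) (1 / 100) (4 / 5 * δ₀) δ₀
      (9 / 10 * δ₀) (Λf (1 / 100)) BG B K (fun a => g.len a) (fun _ => (1 : ℝ)) hBG.le hB hK (fun a => (hlen a).le) (fun _ => zero_le_one)
      hΛ0 hρ0 hr' hrρ hdnn htri hSTone h261β hv hcK h365 h342 hX k1'
    simpa only [mul_one] using h
  · -- (3.42)₃: `(X, Y) = (1, ∇*_l)`, `P = (Lʲη)²`, `Q = (Lʲη)⁻¹`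
    have h342 : HasKernelBound (g := toB6 g Rr H) (fun p : S × ι => blk p.1) v cK (1 * Gp * conj b (diffLetter T U ((g.eta : ℂ)⁻¹) l))
        (fun a a' => BG * (g.len a ^ 2 * (g.len a)⁻¹) * Real.exp (-(δ₀ * g.dist a a'))) := by
      simpa only [one_mul, hl21] using hGpDk l
    have hX : HasMajorant (g := toB6 g Rr H) (fun p : S × ι => blk p.1) (1 * gPrimeExtEnd Gp (conj b (vPrimeConc T U g.eta A blk kQ kF sQ sF cfun) * Gp))
        (fun a a' => B * g.len a ^ 2 * Real.exp (-(9 / 10 * δ₀ * g.dist a a'))) :=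
      hL 1 (fun a => g.len a ^ 2) (fun a => sq_nonneg _) (by simpa only [one_mul] using h342_1)
    have h := gExt_kernelEntry_of_386 (R := Rr) (H := H) (fun p : S × ι => blk p.1) d δ₀ (1 / 100) (1 / 100) (4 / 5 * δ₀) δ₀
      (9 / 10 * δ₀) (Λf (1 / 100)) BG B K (fun a => g.len a ^ 2) (fun a => (g.len a)⁻¹) hBG.le hB hK (fun a => sq_nonneg _)
      (fun a => inv_nonneg.mpr (hlen a).le) hΛ0 hρ0 hr' hrρ hdnn htri hT1i h261β hv hcK h365 h342 hX (k3' l)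
    simpa only [one_mul, hl21] using h
  · -- (3.42)₄: `(X, Y) = (∇_k, ∇*_l)`, `P = Lʲη`, `Q = (Lʲη)⁻¹`
    have h342 : HasKernelBound (g := toB6 g Rr H) (fun p : S × ι => blk p.1) v cK (conj b (diffLetter T U ((g.eta : ℂ)⁻¹) k) * Gp * conj b (diffLetter T U ((g.eta : ℂ)⁻¹) l))
        (fun a a' => BG * (g.len a * (g.len a)⁻¹) * Real.exp (-(δ₀ * g.dist a a'))) := hDGpDk' k l
    have hX : HasMajorant (g := toB6 g Rr H) (fun p : S × ι => blk p.1) (conj b (diffLetter T U ((g.eta : ℂ)⁻¹) k) * gPrimeExtEnd Gp (conj b (vPrimeConc T U g.eta A blk kQ kF sQ sF cfun) * Gp))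
        (fun a a' => B * g.len a * Real.exp (-(9 / 10 * δ₀ * g.dist a a'))) :=
      hL _ (fun a => g.len a) (fun a => (hlen a).le) (h342_2 k)
    have h := gExt_kernelEntry_of_386 (R := Rr) (H := H) (fun p : S × ι => blk p.1) d δ₀ (1 / 100) (1 / 100) (4 / 5 * δ₀) δ₀
      (9 / 10 * δ₀) (Λf (1 / 100)) BG B K (fun a => g.len a) (fun a => (g.len a)⁻¹) hBG.le hB hK (fun a => (hlen a).le)
      (fun a => inv_nonneg.mpr (hlen a).le) hΛ0 hρ0 hr' hrρ hdnn htri hT1i h261β hv hcK h365 h342 hX (k3' l)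
    simpa only [hl10, mul_one] using h

end FinalU

end Literature.MathematicalPhysics.QuantumFieldTheory.Balaban1983to89.B9Thm34GpKernelUniform

end
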